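import Summits.ValiantsHypothesis.ValiantsHypothesis.Theorems.KPlusLogSqLawTropicalCycleMonotone
import Summits.ValiantsHypothesis.ValiantsHypothesis.Theorems.KPlusLogSqLawTropicalBMasterLaw
import Summits.ValiantsHypothesis.ValiantsHypothesis.Theorems.KPlusLogSqLawTropicalBParityCensus
import Summits.ValiantsHypothesis.ValiantsHypothesis.Theorems.KPlusLogSqLawTropicalBRelabel
import Summits.ValiantsHypothesis.ValiantsHypothesis.Theorems.LacunarySymmetroidMatrixDescartesCensusTropicalKLawStatic
import Summits.ValiantsHypothesis.ValiantsHypothesis.Theorems.KPlusLogSqLawTropicalBThreeFourOrderKit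

/-!
# Route «KPlusLogSqLaw», crux `TropicalB` (stmt-ValiantsHypothesis-19771) — certificate kit for ORDER-TYPE LAWS of the `(4,4)` row:
# a pairwise-law search whose surviving branches are closed by FARKAS (master-law) certificates, region-uniform in the exponents

HONEST FRAMING.  Helper toward the registered stubs of `Cruxes/TropicalB/Lines/birth.lean` (crux
`Summit.ValiantsHypothesis.ValiantsHypothesis.Theses.KPlusLogSqLaw.TropicalB`, item `stmt-ValiantsHypothesis-19771`, route `KPlusLogSqLaw`;
cell `pub-symmetroid`, seat val-sym-trop-p5 g12, 2026-08-28; `--supports … --as helper`).  This file is MACHINERY plus its soundness; the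
census statement it serves («the `(3,4)` cell, whose value `T(3,4) = 19 = C(6,3) − 1` is counting-tight, is NOT counting-tight on an explicit
open region of exponent vectors: `T(3,4; d) ≤ 18` there») is the sequel file `…ThreeFourOrderTypeLaw`.  Nothing here bears on `TropicalB` in its
window, `WeakLifting`, the doors, `MatrixDescartes` (stmt-ValiantsHypothesis-18050) or VP ≠ VNP.

WHY A NEW KIT.  The `(3,5)` kit of val-sym-trop-p4 (`…ThreeFiveKit`: order-type pairwise law + `decide`) refutes histogram patterns by the
PAIRWISE EXCHANGE LAW alone; at `K = 4` that law is too weak (every `(3,4)` histogram order admits law-consistent full chains — located, this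
seat), and the obstruction is LP-level.  So a branch of the search that survives the pairwise law is closed here by a FARKAS CERTIFICATE in the
sense of the tree's master law (`…TropicalBMasterLaw`, val-sym-trop-p1): non-negative integer multipliers on (chain position, competitor) pairs
with (1) incidence balance and (2) non-negative prefix slope excesses / zero total.  Condition (2) is linear in the exponent vector `d`; the
certificate carries, for each prefix, a decomposition of its slope-excess form as a non-negative integer combination of three «facet forms»
`G₁, G₂, G₃` assumed non-negative on `d` — so ONE certificate table proves the pattern impossible on the whole closed polyhedral cone
`{G₁ ≥ 0, G₂ ≥ 0, G₃ ≥ 0}` of exponent space (an order-type region), not just at one `d`.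

CONTENT (m = 4, K = 4; abstract terms `AT` = (permutation vector, class vector)).  This is part 1 of 2 (part 2 = `…ThreeFourOrderSearch`).
* `domL Gneg P Q` — pairwise-law violation test for (earlier `P`, later `Q`) given a list `Gneg` of class-count forms known to be `≤ 0` on `d`
  (`domL_sound`, from `sum_d_lt_of_isDominant_invariant`).
* `certOK G pre es mus` — the certificate check: competitors built from the prefix's incidences and different from the chain term, positive
  multipliers, incidence balance (`coef = 0`), every proper prefix slope-excess form `Hvec` equal to the tabulated non-negative combination `comb` of
  the three facet forms, zero total; plus the algebra used by its soundness proof (`val_eq_ind`, `slope_eq_form`, `form_comb`, `form_list_sum`).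
[folklore: LP duality / exchange arguments; packaging: this cell]
-/

set_option linter.dupNamespace false
set_option autoImplicit false

namespace Summit.ValiantsHypothesis.ValiantsHypothesis.Theorems.KPlusLogSqLaw

namespace FourFourCore

open ThreeFourCore (form comb form_comb form_sub form_ite list_sum_comm)
open Summit.ValiantsHypothesis.ValiantsHypothesis.Theorems.MatrixDescartes.Negative
open Summit.ValiantsHypothesis.ValiantsHypothesis.Theorems.LacunarySymmetroidMatrixDescartes.TropicalCensus
open Summit.ValiantsHypothesis.ValiantsHypothesis.Theorems.KPlusLogSqLaw.ConvexPosition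
open Summit.ValiantsHypothesis.ValiantsHypothesis.Theorems.KPlusLogSqLaw.HingeLaw
open Finset

/-! ## 1. Abstract terms, forms, the pairwise-law test -/

/-- abstract term of format `(4,4)`: permutation VECTOR `b ↦ σ b` and class vector. -/
abbrev AT := (Fin 4 → Fin 4) × (Fin 4 → Fin 4)

/-- real term of format `(4,4)`. -/
abbrev RT := Equiv.Perm (Fin 4) × (Fin 4 → Fin 4)

/-- abstraction of a real term. -/
def abs (t : RT) : AT := (⇑t.1, t.2)

/-- the 24 permutation vectors of `Fin 4`. -/
def S3V : List (Fin 4 → Fin 4) :=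
  [![0, 1, 2, 3], ![0, 1, 3, 2], ![0, 2, 1, 3], ![0, 2, 3, 1], ![0, 3, 1, 2], ![0, 3, 2, 1],
   ![1, 0, 2, 3], ![1, 0, 3, 2], ![1, 2, 0, 3], ![1, 2, 3, 0], ![1, 3, 0, 2], ![1, 3, 2, 0],
   ![2, 0, 1, 3], ![2, 0, 3, 1], ![2, 1, 0, 3], ![2, 1, 3, 0], ![2, 3, 0, 1], ![2, 3, 1, 0],
   ![3, 0, 1, 2], ![3, 0, 2, 1], ![3, 1, 0, 2], ![3, 1, 2, 0], ![3, 2, 0, 1], ![3, 2, 1, 0]]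

set_option maxRecDepth 8000 in
/-- every permutation's vector is listed. -/
theorem mem_S3V (σ : Equiv.Perm (Fin 4)) : (⇑σ : Fin 4 → Fin 4) ∈ S3V := by
  revert σ; decide

/-- a permutation with a prescribed vector (identity if the vector is not a permutation vector). -/
def toPerm (f : Fin 4 → Fin 4) : Equiv.Perm (Fin 4) :=
  if f = ![0, 1, 3, 2] then Equiv.swap 2 3 else
  if f = ![0, 2, 1, 3] then Equiv.swap 1 2 else
  if f = ![0, 2, 3, 1] then Equiv.swap 1 2 * Equiv.swap 2 3 else
  if f = ![0, 3, 1, 2] then Equiv.swap 1 2 * Equiv.swap 1 3 else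
  if f = ![0, 3, 2, 1] then Equiv.swap 1 3 else
  if f = ![1, 0, 2, 3] then Equiv.swap 0 1 else
  if f = ![1, 0, 3, 2] then Equiv.swap 0 1 * Equiv.swap 2 3 else
  if f = ![1, 2, 0, 3] then Equiv.swap 0 1 * Equiv.swap 1 2 else
  if f = ![1, 2, 3, 0] then Equiv.swap 0 1 * Equiv.swap 1 2 * Equiv.swap 2 3 else
  if f = ![1, 3, 0, 2] then Equiv.swap 0 1 * Equiv.swap 1 2 * Equiv.swap 1 3 else
  if f = ![1, 3, 2, 0] then Equiv.swap 0 1 * Equiv.swap 1 3 else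
  if f = ![2, 0, 1, 3] then Equiv.swap 0 1 * Equiv.swap 0 2 else
  if f = ![2, 0, 3, 1] then Equiv.swap 0 1 * Equiv.swap 0 2 * Equiv.swap 2 3 else
  if f = ![2, 1, 0, 3] then Equiv.swap 0 2 else
  if f = ![2, 1, 3, 0] then Equiv.swap 0 2 * Equiv.swap 2 3 else
  if f = ![2, 3, 0, 1] then Equiv.swap 0 2 * Equiv.swap 1 3 else
  if f = ![2, 3, 1, 0] then Equiv.swap 0 1 * Equiv.swap 0 2 * Equiv.swap 1 3 else
  if f = ![3, 0, 1, 2] then Equiv.swap 0 1 * Equiv.swap 0 2 * Equiv.swap 0 3 else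
  if f = ![3, 0, 2, 1] then Equiv.swap 0 1 * Equiv.swap 0 3 else
  if f = ![3, 1, 0, 2] then Equiv.swap 0 2 * Equiv.swap 0 3 else
  if f = ![3, 1, 2, 0] then Equiv.swap 0 3 else
  if f = ![3, 2, 0, 1] then Equiv.swap 0 1 * Equiv.swap 0 3 * Equiv.swap 1 2 else
  if f = ![3, 2, 1, 0] then Equiv.swap 0 3 * Equiv.swap 1 2 else 1

set_option maxRecDepth 8000 in
/-- `toPerm` realises every permutation vector. -/
theorem coe_toPerm : ∀ f ∈ S3V, (⇑(toPerm f) : Fin 4 → Fin 4) = f := by decide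

/-- class-count vector of a class vector. -/
def histA (c : Fin 4 → Fin 4) : Fin 4 → ℤ := fun l => ∑ b : Fin 4, if c b = l then 1 else 0

/-- class-count difference (later minus earlier) on a column mask. -/
def deltaVec (P Q : AT) (T : Fin 4 → Bool) : Fin 4 → ℤ :=
  fun l => ∑ b : Fin 4, if T b = true then ((if Q.2 b = l then 1 else 0) - (if P.2 b = l then 1 else 0)) else 0

/-- invariance of the column mask `T` under the two permutations and «the terms differ on `T`» (as in `…ThreeFiveKit`). -/
def invDif (P Q : AT) (T : Fin 4 → Bool) : Bool :=
  decide (∀ b, T b = true → (∃ b', T b' = true ∧ P.1 b' = Q.1 b) ∧ (∃ b', T b' = true ∧ Q.1 b' = P.1 b)) &&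
    decide (∃ b, T b = true ∧ (P.1 b ≠ Q.1 b ∨ P.2 b ≠ Q.2 b))

/-- a form is KNOWN non-positive: it is zero or listed. -/
def known (Gneg : List (Fin 4 → ℤ)) (g : Fin 4 → ℤ) : Bool := decide (g = 0) || decide (g ∈ Gneg)

/-- the fifteen non-empty column masks. -/
def masks : List (Fin 4 → Bool) :=
  [![true, false, false, false], ![false, true, false, false], ![true, true, false, false], ![false, false, true, false],
   ![true, false, true, false], ![false, true, true, false], ![true, true, true, false], ![false, false, false, true],
   ![true, false, false, true], ![false, true, false, true], ![true, true, false, true], ![false, false, true, true],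
   ![true, false, true, true], ![false, true, true, true], ![true, true, true, true]]

/-- **pairwise-law violation test** for (earlier `P`, later `Q`): some invariant mask on which the terms differ has a class-count difference
form known to be `≤ 0`. -/
def domL (Gneg : List (Fin 4 → ℤ)) (P Q : AT) : Bool :=
  masks.any fun T => invDif P Q T && known Gneg (deltaVec P Q T)

section Sound

variable (d : Fin 4 → ℕ) (v ε : Fin 4 → Fin 4 → Fin 4 → ℤ)

/-- the `T`-part of a slope as a form. -/
theorem sum_mask_eq (c : Fin 4 → Fin 4) (T : Fin 4 → Bool) :
    ∑ b ∈ univ.filter (fun b => T b = true), (d (c b) : ℤ) =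
      ∑ l : Fin 4, (∑ b : Fin 4, if T b = true then (if c b = l then (1 : ℤ) else 0) else 0) * (d l : ℤ) := by
  have h1 : ∀ b : Fin 4, (d (c b) : ℤ) = ∑ l : Fin 4, (if c b = l then (1 : ℤ) else 0) * (d l : ℤ) := by
    intro b
    rw [Finset.sum_eq_single (c b)]
    · simp
    · intro l _ hl; simp [Ne.symm hl]
    · intro h; exact absurd (mem_univ _) h
  calc ∑ b ∈ univ.filter (fun b => T b = true), (d (c b) : ℤ)
      = ∑ b ∈ univ.filter (fun b => T b = true), ∑ l : Fin 4, (if c b = l then (1 : ℤ) else 0) * (d l : ℤ) :=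
        Finset.sum_congr rfl fun b _ => h1 b
    _ = ∑ l : Fin 4, ∑ b ∈ univ.filter (fun b => T b = true), (if c b = l then (1 : ℤ) else 0) * (d l : ℤ) := Finset.sum_comm
    _ = _ := by
        refine Finset.sum_congr rfl fun l _ => ?_
        rw [← Finset.sum_mul, Finset.sum_filter]

/-- the difference of the `T`-parts of two slopes is the form `deltaVec`. -/
theorem sum_mask_sub (P Q : AT) (T : Fin 4 → Bool) :
    ∑ b ∈ univ.filter (fun b => T b = true), (d (Q.2 b) : ℤ) - ∑ b ∈ univ.filter (fun b => T b = true), (d (P.2 b) : ℤ) =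
      form (deltaVec P Q T) d := by
  rw [sum_mask_eq, sum_mask_eq, ← Finset.sum_sub_distrib]
  unfold form deltaVec
  refine Finset.sum_congr rfl fun l _ => ?_
  rw [← sub_mul]
  congr 1
  rw [← Finset.sum_sub_distrib]
  refine Finset.sum_congr rfl fun b _ => ?_
  split_ifs <;> simp

/-- the exchange law on an explicit column mask (as in `…ThreeFiveKit.sum_lt_of_invDif`). -/
theorem sum_lt_of_invDif {θ θ' : ℤ} (hθ : θ < θ') (P Q : RT) (hP : IsDominant d v ε θ P) (hQ : IsDominant d v ε θ' Q)
    (T : Fin 4 → Bool) (h : invDif (abs P) (abs Q) T = true) :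
    ∑ b ∈ univ.filter (fun b => T b = true), (d (P.2 b) : ℤ) < ∑ b ∈ univ.filter (fun b => T b = true), (d (Q.2 b) : ℤ) := by
  classical
  unfold invDif abs at h
  rw [Bool.and_eq_true, decide_eq_true_eq, decide_eq_true_eq] at h
  obtain ⟨hinv, b₀, hb₀, hdiff⟩ := h
  have hmem : ∀ b, b ∈ univ.filter (fun b => T b = true) ↔ T b = true := fun b => by simp
  obtain ⟨σ, c⟩ := P
  obtain ⟨ρ, μ⟩ := Q
  refine sum_d_lt_of_isDominant_invariant d v ε hθ hP hQ _ (fun b => ?_) ⟨b₀, (hmem b₀).mpr hb₀, hdiff⟩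
  rw [hmem, hmem]
  constructor
  · intro h1
    obtain ⟨-, ⟨b', hb', hb'eq⟩⟩ := hinv _ h1
    have e1 : σ ((σ⁻¹ * ρ) b) = ρ b := by simp
    have : ρ b' = ρ b := by
      have := hb'eq
      simp only at this
      rw [this, e1]
    rwa [← ρ.injective this]
  · intro h1
    obtain ⟨⟨b', hb', hb'eq⟩, -⟩ := hinv _ h1
    have : (σ⁻¹ * ρ) b = b' := by
      simp only at hb'eq
      simp [Equiv.Perm.mul_apply, ← hb'eq]
    rw [this]; exact hb'

/-- **soundness of `domL`**: with the listed forms `≤ 0` on `d`, no (earlier, later) pair of unique optima passes the test. -/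
theorem domL_sound (Gneg : List (Fin 4 → ℤ)) (hG : ∀ g ∈ Gneg, form g d ≤ 0) {θ θ' : ℤ} (hθ : θ < θ') (P Q : RT)
    (hP : IsDominant d v ε θ P) (hQ : IsDominant d v ε θ' Q) (h : domL Gneg (abs P) (abs Q) = true) : False := by
  unfold domL at h
  rw [List.any_eq_true] at h
  obtain ⟨T, -, hT⟩ := h
  rw [Bool.and_eq_true] at hT
  obtain ⟨h1, h2⟩ := hT
  have hlt := sum_lt_of_invDif d v ε hθ P Q hP hQ T h1
  have heq := sum_mask_sub d (abs P) (abs Q) T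
  have hP2 : (abs P).2 = P.2 := rfl
  have hQ2 : (abs Q).2 = Q.2 := rfl
  rw [hP2, hQ2] at heq
  have hle : form (deltaVec (abs P) (abs Q) T) d ≤ 0 := by
    unfold known at h2
    rw [Bool.or_eq_true, decide_eq_true_eq, decide_eq_true_eq] at h2
    rcases h2 with h2 | h2
    · rw [h2]; simp [form]
    · exact hG _ h2
  linarith

end Sound

/-! ## 2. Farkas certificates (master-law multipliers with facet decompositions) -/

/-- a certificate entry: chain position `k`, competitor abstract term `q`, positive integer multiplier. -/
abbrev Entry := ℕ × AT × ℕ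

/-- incidence indicator of an abstract term at `x = (row, column, class)`. -/
def hasInc (t : AT) (x : Fin 4 × Fin 4 × Fin 4) : Bool := decide (t.1 x.2.1 = x.1 ∧ t.2 x.2.1 = x.2.2)

/-- the same indicator as an integer. -/
def indI (t : AT) (x : Fin 4 × Fin 4 × Fin 4) : ℤ := if hasInc t x = true then 1 else 0

/-- default abstract term. -/
def D0 : AT := (![0, 1, 2, 3], ![0, 0, 0, 0])

/-- balance coefficient of the certificate at the incidence `x`. -/
def coef (pre : List AT) (es : List Entry) (x : Fin 4 × Fin 4 × Fin 4) : ℤ :=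
  (es.map fun e => (e.2.2 : ℤ) * (indI (pre.getD e.1 D0) x - indI e.2.1 x)).sum

/-- class-count excess form of the prefix `k ≤ j`. -/
def Hvec (pre : List AT) (es : List Entry) (j : ℕ) : Fin 4 → ℤ := fun l =>
  (es.map fun e => if e.1 ≤ j then (e.2.2 : ℤ) * (histA (pre.getD e.1 D0).2 l - histA e.2.1.2 l) else 0).sum

/-- **certificate check** for the prefix `pre` (abstract terms in chain order): entries well-formed (position in range, competitor a
permutation vector different from the chain term, built from incidences of the prefix, positive multiplier), incidence balance, every proper
prefix excess form is the tabulated non-negative combination of the facet forms, and the total excess form vanishes. -/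
def certOK (G : (Fin 4 → ℤ) × (Fin 4 → ℤ) × (Fin 4 → ℤ)) (pre : List AT) (es : List Entry) (mus : List (ℕ × ℕ × ℕ)) : Bool :=
  decide (es ≠ []) &&
  (es.all fun e => decide (e.1 < pre.length) && decide (e.2.1 ≠ pre.getD e.1 D0) &&
      decide (e.2.1.1 ∈ S3V) && decide (0 < e.2.2) &&
      decide (∀ b : Fin 4, ∃ t ∈ pre, hasInc t (e.2.1.1 b, b, e.2.1.2 b) = true)) &&
  decide (∀ x : Fin 4 × Fin 4 × Fin 4, coef pre es x = 0) &&
  decide (∀ j : Fin (pre.length - 1), Hvec pre es j = comb G (mus.getD j (0, 0, 0))) &&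
  decide (Hvec pre es (pre.length - 1) = 0)

section CertSound

variable (d : Fin 4 → ℕ) (v ε : Fin 4 → Fin 4 → Fin 4 → ℤ)

/-- splitting the multiplier-weighted sum of differences over a certificate's entries. -/
theorem sum_mul_sub (l : List Entry) (x y : Entry → ℤ) :
    (l.map fun e => (e.2.2 : ℤ) * (x e - y e)).sum = (l.map fun e => (e.2.2 : ℤ) * x e).sum - (l.map fun e => (e.2.2 : ℤ) * y e).sum := by
  induction l with
  | nil => simp
  | cons a l ih => simp only [List.map_cons, List.sum_cons, ih]; ring

/-- the valuation of a real term as an incidence-indicator sum. -/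
theorem val_eq_ind (t : RT) :
    (∑ b, v (t.1 b) b (t.2 b)) = ∑ x : Fin 4 × Fin 4 × Fin 4, indI (abs t) x * v x.1 x.2.1 x.2.2 := by
  classical
  have hx : ∀ b : Fin 4, v (t.1 b) b (t.2 b) =
      ∑ x : Fin 4 × Fin 4 × Fin 4, (if x = (t.1 b, b, t.2 b) then (1 : ℤ) else 0) * v x.1 x.2.1 x.2.2 := by
    intro b
    rw [Finset.sum_eq_single (t.1 b, b, t.2 b)]
    · simp
    · intro x _ hx; simp [hx]
    · intro h; exact absurd (mem_univ _) h
  simp_rw [hx]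
  rw [Finset.sum_comm]
  refine Finset.sum_congr rfl fun x _ => ?_
  rw [← Finset.sum_mul]
  congr 1
  unfold indI hasInc abs
  obtain ⟨r, b, l⟩ := x
  simp only
  by_cases h : t.1 b = r ∧ t.2 b = l
  · rw [if_pos (by simpa using h), Finset.sum_eq_single b]
    · simp [h.1, h.2]
    · intro b' _ hb'
      have hne : ¬ ((r, b, l) = (t.1 b', b', t.2 b')) := by
        intro hh; simp only [Prod.mk.injEq] at hh; exact hb' hh.2.1.symm
      rw [if_neg hne]
    · intro hb; exact absurd (mem_univ _) hb
  · rw [if_neg (by simpa using h)]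
    refine Finset.sum_eq_zero fun b' _ => ?_
    split_ifs with hh
    · exfalso
      simp only [Prod.mk.injEq] at hh
      obtain ⟨h1, h2, h3⟩ := hh
      subst h2
      exact h ⟨h1.symm, h3.symm⟩
    · rfl

/-- the slope of a real term as a class-count form. -/
theorem slope_eq_form (t : RT) :
    Summit.ValiantsHypothesis.ValiantsHypothesis.Theorems.LacunarySymmetroidMatrixDescartes.TropicalCensus.slope d t = form (histA t.2) d := by
  unfold Summit.ValiantsHypothesis.ValiantsHypothesis.Theorems.LacunarySymmetroidMatrixDescartes.TropicalCensus.slope form histA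
  have hb : ∀ b : Fin 4, (d (t.2 b) : ℤ) = ∑ l : Fin 4, (if t.2 b = l then (1 : ℤ) else 0) * (d l : ℤ) := by
    intro b
    rw [Finset.sum_eq_single (t.2 b)]
    · simp
    · intro l _ hl; simp [Ne.symm hl]
    · intro h; exact absurd (mem_univ _) h
  simp_rw [hb]
  rw [Finset.sum_comm]
  refine Finset.sum_congr rfl fun l _ => ?_
  rw [Finset.sum_mul]

/-- `form` of a list sum of vectors. -/
theorem form_list_sum (l : List Entry) (g : Entry → Fin 4 → ℤ) :
    form (fun x => (l.map fun e => g e x).sum) d = (l.map fun e => form (g e) d).sum := by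
  induction l with
  | nil => simp [form]
  | cons a l ih =>
    simp only [List.map_cons, List.sum_cons]
    rw [← ih]
    unfold form
    rw [← Finset.sum_add_distrib]
    refine Finset.sum_congr rfl fun x _ => by ring

/-- a term whose incidences are all present is present. -/
theorem termSign_ne_zero_of_present (q : RT) (h : ∀ b, ε (q.1 b) b (q.2 b) ≠ 0) : termSign ε q ≠ 0 := by
  unfold termSign
  refine mul_ne_zero (Units.ne_zero _) ?_
  rw [Finset.prod_ne_zero_iff]
  exact fun b _ => h b

/-- the identity permutation's vector on `Fin 4`. -/
theorem coe_one4 : (⇑(1 : Equiv.Perm (Fin 4)) : Fin 4 → Fin 4) = ![0, 1, 2, 3] := by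
  funext b; fin_cases b <;> rfl

end CertSound

end FourFourCore

end Summit.ValiantsHypothesis.ValiantsHypothesis.Theorems.KPlusLogSqLaw
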